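import Summits.BirchSwinnertonDyer.BirchSwinnertonDyer.Theorems.KimAtThreeDeepUpperValueRowsGeneral
import HarnessLib

/-!
# The value row of the Kato–Kurihara port with a twist of augmentation `p^α · unit` — the good ANOMALOUS prime
# (cell `bsd-addord`, seat w2-c3 gen 6; route W2 `KimAtThreeKolyvagin`, crux 19076 `DeepUpperAtThree`, child
# 19562 — its good anomalous rows at `3`: `3 ∣ #Ẽ(𝔽₃)`, i.e. `a₃ ∈ {−2, 1}`)

HONEST FRAMING: TOOL theorems (no definition, no named fact, no instance, no `sorry`); nothing about any curve
is asserted; nothing booked; BSD is not proved by any of this.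

## What, and why

This seat's `KimAtThreeDeepUpperValueRowsGeneral` absorbs the `p`-Euler factor of Kato's depleted `L`-value
into the twist `V` and needs the COMBINED certificate `v_p(uκ·∏_{q∣pA}E_q(1)) = 0` for `V` to have UNIT
augmentation — impossible at a good ANOMALOUS `p`, where `E_p(1) = #Ẽ(𝔽_p)/p` and `v_p(uκ) ≥ 1` force
`v_p(aug V) = v_p(#Ẽ(𝔽_p)) =: α ≥ 1` (at `p = 3`: `#Ẽ(𝔽₃) = 4 − a₃ ∈ {3, 6}`, so `α = 1`).  This file is
the non-unit twin of the two value-row steps: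
* `exists_units_sum_coeff_eq_pow_mul` — an integral twist whose rational augmentation has valuation `α` has
  `Σ_g V_g = p^α · w`, `w ∈ ℤ_pˣ`;
* ★★ `exists_valueRow_of_mem_map_span_pow` — T-PK6-VROW FILE 1 ★★ with `hV : Σ_g V_g = p^α · w`:
  `s̄ = u · p^t · (p^α · δ̃)`;
* ★★ `valueRow_of_zetaBody_pow` — `valueRow_of_zetaBody_general` with the combined certificate
  `v_p(uκ·∏_{q∣pA}E_q(1)) = α`: the value row `s̄ = u · p^t · (p^α · δ̃_n)` from `ZetaBody`.
Downstream (seat files to follow) the factor `p^α` moves to the Kurihara side of the two-exponent witness clause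
(`KatoKuriharaWitnessAtTwoExp W k (t + α) e`), which seat w2-acc1's END takes at any exponent.
References: [Kim2022StructureSelmer] Lemma 3.4, §3.2.3, §3.4.1–§3.5, proof of Thm. 3.13; [KimNakamura2020]
Prop. 3.5; [Kato2004Asterisque] Thm. 6.6 (1), §6.2, Thm. 9.7; this seat's NOTES `## Design (gen 6)`.
-/

noncomputable section

open scoped BigOperators NumberField TensorProduct
open Finset IsDedekindDomain NumberField Field WeierstrassCurve Rat.HeightOneSpectrum MonoidAlgebra
open Literature.NumberTheory.GaloisRepresentations Literature.NumberTheory.GaloisCohomology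
open Literature.NumberTheory.LFunctions (absNorm_asIdeal_eq_primesEquiv)
open Literature.NumberTheory.EllipticCurves Literature.NumberTheory.EllipticCurves.ModularForms
open Literature.NumberTheory.EllipticCurves.Kato2004
open Literature.NumberTheory.EllipticCurves.Kato2004.EulerSystemValues
open Summit.BirchSwinnertonDyer.Rank1Residual.GaloisImage
open Summit.BirchSwinnertonDyer.Rank1Residual.GaloisImage.ValueRow

-- the cell's Theorems namespace repeats the summit name by design (D-0017)
set_option linter.dupNamespace false

namespace Summit.BirchSwinnertonDyer.BirchSwinnertonDyer.Theorems.KimAtThreeDeepUpperValueRowPow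

/-! ### §1 Augmentation of valuation `α` -/

section Aug

variable (p : ℕ) [Fact p.Prime] {n : ℕ} [NeZero n]

/-- **An integral twist whose rational model has augmentation of valuation `α` has `Σ_g V_g = p^α · w` with
`w` a `p`-adic unit** (`V^{ℚ_p} = Vq^{ℚ_p}`, `aug Vq ≠ 0`, `v_p(aug Vq) = α`; `unitCoeff`). [folklore] -/
theorem exists_units_sum_coeff_eq_pow_mul (V : MonoidAlgebra ℤ_[p] (ZMod n)ˣ) (Vq : MonoidAlgebra ℚ (ZMod n)ˣ)
    (hV : MonoidAlgebra.mapRingHom (ZMod n)ˣ (PadicInt.Coe.ringHom (p := p)) V =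
      MonoidAlgebra.mapRingHom (ZMod n)ˣ (algebraMap ℚ ℚ_[p]) Vq)
    (h0 : ∑ g : (ZMod n)ˣ, Vq.coeff g ≠ 0) (α : ℕ) (hval : padicValRat p (∑ g : (ZMod n)ˣ, Vq.coeff g) = α) :
    ∃ w : ℤ_[p]ˣ, ∑ g : (ZMod n)ˣ, V.coeff g = (p : ℤ_[p]) ^ α * (w : ℤ_[p]) := by
  have h := congrArg (fun Y : MonoidAlgebra ℚ_[p] (ZMod n)ˣ => ∑ g : (ZMod n)ˣ, Y.coeff g) hV
  simp only [sum_coeff_mapRingHom] at h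
  have hX : ((∑ g : (ZMod n)ˣ, V.coeff g : ℤ_[p]) : ℚ_[p]) = ((∑ g : (ZMod n)ˣ, Vq.coeff g : ℚ) : ℚ_[p]) := by
    simpa using h
  have hX0 : (∑ g : (ZMod n)ˣ, V.coeff g : ℤ_[p]) ≠ 0 := by
    intro h0'
    rw [h0', PadicInt.coe_zero] at hX
    exact h0 (by exact_mod_cast hX.symm)
  have hvalN : (∑ g : (ZMod n)ˣ, V.coeff g : ℤ_[p]).valuation = α := by
    have h1 : (((∑ g : (ZMod n)ˣ, V.coeff g : ℤ_[p]).valuation : ℕ) : ℤ) = (α : ℤ) := by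
      rw [← PadicInt.valuation_coe, hX, Padic.valuation_ratCast, hval]
    exact_mod_cast h1
  refine ⟨PadicInt.unitCoeff hX0, ?_⟩
  rw [mul_comm]
  conv_lhs => rw [PadicInt.unitCoeff_spec hX0]
  rw [hvalN]

/-- **The augmentation of the twist `Vq = (1 + δ₋₁)·δ_{u⁻¹}uκ·E·C⁻` is non-zero of valuation `α`** as soon as
`p ≠ 2`, `uκ ≠ 0`, `E(1) ≠ 0`, `R⁻ ≠ 0`, `v_p(uκ·E(1)) = α`, `v_p(R⁻) = 0` (FILE 2 `sum_coeff_twist_eq`: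
`aug Vq = 2·uκ·E(1)·R⁻`). [cite: Kato2004Asterisque, Thm. 6.6 (1) (p. 163) and §6.2 (p. 161)] -/
theorem sum_coeff_twist_ne_zero_and_padicValRat_eq (hp2 : p ≠ 2) {N₀ : ℕ}
    (f : CuspForm (CongruenceSubgroup.Gamma0 N₀) 2)
    (u : (ZMod n)ˣ) (uκ : ℚ) (M N : ℕ) (uq : ℕ → (ZMod n)ˣ) (aM : ℕ → ℤ)
    (Eq : MonoidAlgebra ℚ (ZMod n)ˣ)
    (hEq : Eq = ∏ q ∈ M.primeFactors, (1 - MonoidAlgebra.single (uq q)⁻¹ ((aM q : ℚ) / q) +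
      MonoidAlgebra.single ((uq q)⁻¹ ^ 2) (if q ∣ N then 0 else (1 / q : ℚ))))
    (c d a d' : ℤ) (A : ℕ) (uc ud : (ZMod n)ˣ)
    (Cq : MonoidAlgebra ℚ (ZMod n)ˣ)
    (hCq : Cq = algebraMap ℚ _ ((c : ℚ) ^ 2 * (d : ℚ) ^ 2 * ratMinusSymbol f ((a : ℚ) / A)) -
      MonoidAlgebra.single uc ((c : ℚ) * (d : ℚ) ^ 2 * ratMinusSymbol f ((a * c : ℚ) / A)) -
      MonoidAlgebra.single ud ((c : ℚ) ^ 2 * (d : ℚ) * ratMinusSymbol f ((a * d' : ℚ) / A)) +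
      MonoidAlgebra.single (uc * ud) ((c : ℚ) * (d : ℚ) * ratMinusSymbol f ((a * c * d' : ℚ) / A)))
    (Vq : MonoidAlgebra ℚ (ZMod n)ˣ)
    (hVq : Vq = (1 + MonoidAlgebra.single (-1 : (ZMod n)ˣ) (1 : ℚ)) * MonoidAlgebra.single u⁻¹ uκ * Eq * Cq)
    (huκ0 : uκ ≠ 0)
    (hE0 : ∏ q ∈ M.primeFactors, (1 - (aM q : ℚ) / q + (if q ∣ N then 0 else (1 / q : ℚ))) ≠ 0)
    (α : ℕ)
    (hκE : padicValRat p
      (uκ * ∏ q ∈ M.primeFactors, (1 - (aM q : ℚ) / q + (if q ∣ N then 0 else (1 / q : ℚ)))) = α)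
    (hR0 : (c : ℚ) ^ 2 * (d : ℚ) ^ 2 * ratMinusSymbol f ((a : ℚ) / A) -
        (c : ℚ) * (d : ℚ) ^ 2 * ratMinusSymbol f ((a * c : ℚ) / A) -
        (c : ℚ) ^ 2 * (d : ℚ) * ratMinusSymbol f ((a * d' : ℚ) / A) +
        (c : ℚ) * (d : ℚ) * ratMinusSymbol f ((a * c * d' : ℚ) / A) ≠ 0)
    (hR : padicValRat p ((c : ℚ) ^ 2 * (d : ℚ) ^ 2 * ratMinusSymbol f ((a : ℚ) / A) -
        (c : ℚ) * (d : ℚ) ^ 2 * ratMinusSymbol f ((a * c : ℚ) / A) -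
        (c : ℚ) ^ 2 * (d : ℚ) * ratMinusSymbol f ((a * d' : ℚ) / A) +
        (c : ℚ) * (d : ℚ) * ratMinusSymbol f ((a * c * d' : ℚ) / A)) = 0) :
    ∑ g : (ZMod n)ˣ, Vq.coeff g ≠ 0 ∧ padicValRat p (∑ g : (ZMod n)ˣ, Vq.coeff g) = α := by
  haveI : Fact p.Prime := inferInstance
  have haug := sum_coeff_twist_eq f u uκ M N uq aM Eq hEq c d a d' A uc ud Cq hCq Vq hVq
  refine ⟨?_, ?_⟩
  · rw [haug]
    exact mul_ne_zero (mul_ne_zero (mul_ne_zero two_ne_zero huκ0) hE0) hR0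
  · rw [haug, mul_assoc (2 : ℚ) uκ, padicValRat.mul (mul_ne_zero two_ne_zero (mul_ne_zero huκ0 hE0)) hR0,
      padicValRat.mul two_ne_zero (mul_ne_zero huκ0 hE0), hκE, hR]
    have h2 : padicValRat p 2 = 0 := by
      rw [show (2 : ℚ) = ((2 : ℕ) : ℚ) by norm_num, padicValRat.of_nat]
      norm_cast
      exact padicValNat.eq_zero_of_not_dvd fun h =>
        hp2 ((Nat.prime_dvd_prime_iff_eq Fact.out Nat.prime_two).1 h)
    rw [h2]
    ring

end Aug

/-! ### §2 ★★ The value row from the comparison, augmentation `p^α · unit` -/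

section Row

variable (p : ℕ) [Fact p.Prime]
variable {W : WeierstrassCurve ℚ} [W.IsElliptic] [W.IsGloballyMinimal]
variable {N₀ : ℕ} [NeZero N₀] (f : CuspForm (CongruenceSubgroup.Gamma0 N₀) 2)


set_option backward.isDefEq.respectTransparency false in
/-- **★★ The VALUE ROW from the comparison, twist of augmentation `p^α · unit`** — n1011-p02's
`ValueRow.exists_valueRow_of_mem_map_span` (T-PK6-VROW FILE 1 ★★) with the unit-augmentation binder `hV`
REPLACED by `Σ_g V_g = p^α · w`, `w ∈ ℤ_pˣ`: the scalar of PK-3's identity twisted by `V` is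
`(−1)^ν δ̃ · p^α w̄`, so the value row reads `∃ s u ψ, hval(s) ∧ s̄ = u · p^t · (p^α · δ̃)` — the Kurihara
number acquires the factor `p^α`.  The case of a good ANOMALOUS prime `p` (`p ∣ #Ẽ(𝔽_p)`), where the twist
containing Kato's depletion factor `E_p(σ_p)` has augmentation `p^{v_p(#Ẽ(𝔽_p))} · unit`.  Proof = FILE 1's,
token for token, with `δ := p^α · δ̃`.
[cite: Kim2022StructureSelmer, §3.4.1–§3.5 and the proof of Thm. 3.13 (arXiv v3 pp. 26–28; = Thm. 3.11 of AJM 148)]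
[cite: KimNakamura2020, Prop. 3.5 and Rem. 3.6 (arXiv v2 pp. 8–9)] -/
theorem exists_valueRow_of_mem_map_span_pow (hp2 : p ≠ 2) (hf : IsNewformOf W f)
    (hirr : W.HasIrreducibleModPGaloisRep p) (k t : ℕ)
    (σ : HeightOneSpectrum (𝓞 ℚ) → absoluteGaloisGroup ℚ)
    (η : (q : HeightOneSpectrum (𝓞 ℚ)) → (ZMod (Ideal.absNorm q.asIdeal))ˣ)
    (hσI : ∀ q, σ q ∈ (adicCompletionPrime ℚ q).inertia (absoluteGaloisGroup ℚ))
    (hσχ : ∀ q, modNCyclotomicCharacter ℚ (Ideal.absNorm q.asIdeal) (σ q) = η q)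
    (r : Finset (HeightOneSpectrum (𝓞 ℚ)))
    (hη : ∀ q ∈ r, Subgroup.zpowers (η q) = ⊤)
    (hKol : ∀ q ∈ r, Kato.IsKolyvaginPrime W p (k + 1) ((primesEquiv q : Nat.Primes) : ℕ))
    (xr : CyclotomicField (cycLevel p 0 r) ℚ) (X : MonoidAlgebra ℚ (ZMod (cycLevel p 0 r))ˣ)
    (hxX : xr = ∑ g : (ZMod (cycLevel p 0 r))ˣ, X.coeff g •
      sigma (cycLevel p 0 r) g (IsCyclotomicExtension.zeta (cycLevel p 0 r) ℚ
        (CyclotomicField (cycLevel p 0 r) ℚ)))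
    (Θ₀ : MonoidAlgebra ℤ_[p] (ZMod (cycLevel p 0 r))ˣ)
    (hΘ : ∀ a : (ZMod (cycLevel p 0 r))ˣ, ((Θ₀.coeff a : ℤ_[p]) : ℚ_[p]) =
      ((ratPlusSymbol f ((((a : ZMod (cycLevel p 0 r))).val : ℚ) / (cycLevel p 0 r)) : ℚ) : ℚ_[p]))
    (V : MonoidAlgebra ℤ_[p] (ZMod (cycLevel p 0 r))ˣ) (α : ℕ) (w : ℤ_[p]ˣ)
    (hV : ∑ g : (ZMod (cycLevel p 0 r))ˣ, V.coeff g = (p : ℤ_[p]) ^ α * (w : ℤ_[p]))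
    (hmem : (∏ q ∈ r, ∑ j : Fin (((primesEquiv q : Nat.Primes) : ℕ) - 1),
          MonoidAlgebra.single (modNCyclotomicCharacter ℚ (cycLevel p 0 r) (σ q) ^ (j : ℕ))
            ((j : ℕ) : ℚ_[p])) *
        (MonoidAlgebra.mapRingHom (ZMod (cycLevel p 0 r))ˣ (algebraMap ℚ ℚ_[p])
            (((cycLevel p 0 r : ℕ) : ℚ) •
              ((1 + MonoidAlgebra.single (-1 : (ZMod (cycLevel p 0 r))ˣ) (1 : ℚ)) * X)) -
          MonoidAlgebra.mapRingHom (ZMod (cycLevel p 0 r))ˣ (PadicInt.Coe.ringHom (p := p)) (Θ₀ * V)) ∈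
      (Ideal.span {((p : MonoidAlgebra ℤ_[p] (ZMod (cycLevel p 0 r))ˣ)) ^ (k + 1)}).toAddSubmonoid.map
        (MonoidAlgebra.mapRingHom (ZMod (cycLevel p 0 r))ˣ (PadicInt.Coe.ringHom (p := p)) :
          MonoidAlgebra ℤ_[p] (ZMod (cycLevel p 0 r))ˣ →+ MonoidAlgebra ℚ_[p] (ZMod (cycLevel p 0 r))ˣ)) :
    ∃ (s : ℤ_[p]) (u : (ZMod (p ^ (k + 1)))ˣ)
      (ψ : (ℓ : ℕ) → (ZMod ℓ)ˣ →* Multiplicative (ZMod (p ^ (k + 1)))),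
      (∀ q ∈ r, Function.Surjective (ψ (Ideal.absNorm q.asIdeal))) ∧
      (∃ l ∈ cycIntLattice p (cycLevel p 0 r),
        ((p : ℤ_[p]) ^ t) • ((1 : ℚ_[p]) ⊗ₜ[ℚ]
          ((r.noncommProd (fun ℓ : HeightOneSpectrum (𝓞 ℚ) =>
              ∑ j ∈ Finset.range (((primesEquiv ℓ : Nat.Primes) : ℕ) - 1),
                (j : Module.End ℚ (CyclotomicField (cycLevel p 0 r) ℚ)) *
                  (sigma (cycLevel p 0 r) (modNCyclotomicCharacter ℚ (cycLevel p 0 r) (σ ℓ)) :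
                    CyclotomicField (cycLevel p 0 r) ℚ →ₐ[ℚ]
                      CyclotomicField (cycLevel p 0 r) ℚ).toLinearMap ^ j)
            (ZetaValue.pairwise_commute_fieldDeriv (cycLevel p 0 r)
              (fun ℓ => modNCyclotomicCharacter ℚ (cycLevel p 0 r) (σ ℓ))
              (fun ℓ => ((primesEquiv ℓ : Nat.Primes) : ℕ) - 1) r))
            (xr + sigma (cycLevel p 0 r) (-1) xr))) -
          ((s : ℚ_[p]) ⊗ₜ[ℚ] (1 : CyclotomicField (cycLevel p 0 r) ℚ)) =
        ((p : ℤ_[p]) ^ (k + 1)) • (l : ℚ_[p] ⊗[ℚ] CyclotomicField (cycLevel p 0 r) ℚ)) ∧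
      haveI : NeZero (∏ q ∈ r, Ideal.absNorm q.asIdeal) :=
        ⟨Finset.prod_ne_zero_iff.2 fun q _ h => q.ne_bot (Ideal.absNorm_eq_zero_iff.1 h)⟩
      PadicInt.toZModPow (k + 1) s = (u : ZMod (p ^ (k + 1))) *
        ((p : ℕ) : ZMod (p ^ (k + 1))) ^ t *
          (((p : ℕ) : ZMod (p ^ (k + 1))) ^ α *
            kuriharaNumber f (p ^ (k + 1)) (∏ q ∈ r, Ideal.absNorm q.asIdeal) ψ) := by
  classical
  haveI : NeZero (p ^ (k + 1)) := ⟨pow_ne_zero _ (Fact.out : p.Prime).ne_zero⟩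
  -- ### the level `n = n(r)`: square-free Kolyvagin product, prime to `p`, reindexed by the places
  have hsf : Squarefree (cycLevel p 0 r) := TameLevel.squarefree_cycLevel_zero p r
  have hrp : ∀ q ∈ r, ((primesEquiv q : Nat.Primes) : ℕ) ≠ p := fun q hq => (hKol q hq).ne
  have hKP : Kato.IsKolyvaginProduct W p (k + 1) (cycLevel p 0 r) := by
    refine ⟨hsf, fun ℓ hℓ => ?_⟩
    rw [TameLevel.primeFactors_cycLevel_zero, Finset.mem_image] at hℓ
    obtain ⟨q, hq, rfl⟩ := hℓ
    exact hKol q hq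
  obtain ⟨e, he⟩ := TameLevel.exists_equiv_primeFactors_cycLevel_zero p r
  have hne : ∀ q : r, NeZero (((e q : (cycLevel p 0 r).primeFactors) : ℕ)) := fun q =>
    ⟨(Nat.prime_of_mem_primeFactors (e q).2).ne_zero⟩
  -- `(e q : ℕ) = ℓ_q = N𝔮`
  have heN : ∀ q : r, (((e q : (cycLevel p 0 r).primeFactors) : ℕ)) =
      Ideal.absNorm (q : HeightOneSpectrum (𝓞 ℚ)).asIdeal := fun q => by
    rw [he q, absNorm_asIdeal_eq_primesEquiv]
  -- ### the logarithms `ψ`, normalised at THEOREM D's `η`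
  have hm : ∀ q ∈ r, p ^ (k + 1) ∣ Ideal.absNorm q.asIdeal - 1 := fun q hq => by
    rw [absNorm_asIdeal_eq_primesEquiv]
    exact (Nat.modEq_iff_dvd' (hKol q hq).prime.one_lt.le).1 (hKol q hq).modEq_one.symm
  obtain ⟨ψ, hψ⟩ := exists_family_surjective_normalised (p ^ (k + 1)) r η hη hm
  -- ### PK-3's generator hypotheses for `b_q = χ_n(σ_q)` (T-PK6-VAL FILE 3 ★)
  have hoff : ∀ q q' : r, q ≠ q' →
      ZMod.unitsMap (Nat.dvd_of_mem_primeFactors (e q').2)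
        (modNCyclotomicCharacter ℚ (cycLevel p 0 r) (σ q)) = 1 := fun q q' hqq' =>
    unitsMap_modNCyclotomicCharacter_eq_one_of_mem_inertia p σ hσI r q (e q').2 fun h =>
      hqq' (Subtype.ext (primesEquiv.injective (Subtype.ext ((he q').symm.trans h).symm)))
  have hcyc : ∀ q : r, ∀ y : (ZMod (((e q : (cycLevel p 0 r).primeFactors) : ℕ)))ˣ,
      y ∈ Subgroup.zpowers (ZMod.unitsMap (Nat.dvd_of_mem_primeFactors (e q).2)
        (modNCyclotomicCharacter ℚ (cycLevel p 0 r) (σ q))) := by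
    intro q y
    haveI := hne q
    rw [unitsMap_modNCyclotomicCharacter_of_dvd ℚ (Nat.dvd_of_mem_primeFactors (e q).2) (σ q),
      ← unitsMap_modNCyclotomicCharacter_of_dvd ℚ (dvd_of_eq (heN q)) (σ q), hσχ]
    exact forall_mem_zpowers_unitsMap_of_eq (heN q) (η q) (hη q q.2) y
  have hψe : ∀ q : r, Multiplicative.toAdd
      (ψ (((e q : (cycLevel p 0 r).primeFactors) : ℕ))
        (ZMod.unitsMap (Nat.dvd_of_mem_primeFactors (e q).2)
          (modNCyclotomicCharacter ℚ (cycLevel p 0 r) (σ q)))) = 1 := by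
    intro q
    haveI := hne q
    rw [unitsMap_modNCyclotomicCharacter_of_dvd ℚ (Nat.dvd_of_mem_primeFactors (e q).2) (σ q),
      ← unitsMap_modNCyclotomicCharacter_of_dvd ℚ (dvd_of_eq (heN q)) (σ q), hσχ]
    exact (hψ _ q q.2 (heN q)).2
  obtain ⟨hσψ', hord', hgen'⟩ := UnitsCRT.generator_hypotheses_of_equiv (cycLevel p 0 r) r e
    (fun q => modNCyclotomicCharacter ℚ (cycLevel p 0 r) (σ q)) hsf hoff hcyc ψ hψe
  -- ### PK-3 (Kim–Nakamura Prop. 3.5) at the level `n(r)`, reindexed by the places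
  have hPK3 := MazurTateDerivative.mapRingHom_padicLift_mul_prod_deriv_eq_kuriharaNumber_smul f (k + 1)
    hf hp2 hirr hKP ψ hΘ (fun ℓ => modNCyclotomicCharacter ℚ (cycLevel p 0 r) (σ (e.symm ℓ)))
    hσψ' hord' hgen'
  have hb : ∀ q : r, modNCyclotomicCharacter ℚ (cycLevel p 0 r) (σ q) =
      (fun ℓ : (cycLevel p 0 r).primeFactors =>
        modNCyclotomicCharacter ℚ (cycLevel p 0 r) (σ (e.symm ℓ))) (e q) := fun q => by
    simp only [Equiv.symm_apply_apply]
  have hN : ∀ q : r, ((primesEquiv (q : HeightOneSpectrum (𝓞 ℚ)) : Nat.Primes) : ℕ) - 1 =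
      (fun ℓ : (cycLevel p 0 r).primeFactors => (ℓ : ℕ) - 1) (e q) := fun q => by
    simp only [he q]
  rw [GroupRingEval.prod_sum_fin_single_pow_eq_of_equiv r e
      (fun ℓ : (cycLevel p 0 r).primeFactors =>
        modNCyclotomicCharacter ℚ (cycLevel p 0 r) (σ (e.symm ℓ))) (fun ℓ => (ℓ : ℕ) - 1)
      (fun q => modNCyclotomicCharacter ℚ (cycLevel p 0 r) (σ q))
      (fun q => ((primesEquiv q : Nat.Primes) : ℕ) - 1) (fun j => ((j : ℕ) : ZMod (p ^ (k + 1)))) hb hN,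
    GroupRingEval.prod_sum_fin_single_pow_eq_of_equiv r e
      (fun ℓ : (cycLevel p 0 r).primeFactors =>
        modNCyclotomicCharacter ℚ (cycLevel p 0 r) (σ (e.symm ℓ))) (fun ℓ => (ℓ : ℕ) - 1)
      (fun q => modNCyclotomicCharacter ℚ (cycLevel p 0 r) (σ q))
      (fun q => ((primesEquiv q : Nat.Primes) : ℕ) - 1) (fun _ => (1 : ZMod (p ^ (k + 1)))) hb hN] at hPK3
  -- `∏ Nrm = Σ_g δ_g` (T-PKEV E-A), reindexed
  have hnorm : ∏ q ∈ r, ∑ j : Fin (((primesEquiv q : Nat.Primes) : ℕ) - 1),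
      MonoidAlgebra.single (modNCyclotomicCharacter ℚ (cycLevel p 0 r) (σ q) ^ (j : ℕ)) (1 : ℤ_[p]) =
        ∑ g : (ZMod (cycLevel p 0 r))ˣ, MonoidAlgebra.single g 1 := by
    rw [← GroupRingEval.prod_sum_fin_single_pow_eq_of_equiv r e
      (fun ℓ : (cycLevel p 0 r).primeFactors =>
        modNCyclotomicCharacter ℚ (cycLevel p 0 r) (σ (e.symm ℓ))) (fun ℓ => (ℓ : ℕ) - 1)
      (fun q => modNCyclotomicCharacter ℚ (cycLevel p 0 r) (σ q))
      (fun q => ((primesEquiv q : Nat.Primes) : ℕ) - 1) (fun _ => (1 : ℤ_[p])) hb hN]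
    exact GroupRingEval.prod_norm_eq_sum_single _ _ hgen'
      (GroupRingEval.card_units_zmod_eq_prod_sub_one (cycLevel p 0 r) hsf)
  -- ### the twist by `V` (T-PK6-VAL FILE 1 ★): scalar `((−1)^ν δ̃) · aug V̄`, `aug V̄` a unit
  have hD := GroupRingEval.mapRingHom_mul_mul_prod_deriv_eq_smul p (cycLevel p 0 r) r
    (fun q => modNCyclotomicCharacter ℚ (cycLevel p 0 r) (σ q))
    (fun q => ((primesEquiv q : Nat.Primes) : ℕ) - 1) Θ₀ V (k + 1) _ hPK3 hnorm
  set wK : (ZMod (p ^ (k + 1)))ˣ := Units.map (PadicInt.toZModPow (p := p) (k + 1)).toMonoidHom w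
    with hwK_def
  have hV' : ∑ g : (ZMod (cycLevel p 0 r))ˣ,
      (MonoidAlgebra.mapRingHom (ZMod (cycLevel p 0 r))ˣ (PadicInt.toZModPow (k + 1)) V).coeff g =
        ((p : ℕ) : ZMod (p ^ (k + 1))) ^ α * (wK : ZMod (p ^ (k + 1))) := by
    simp_rw [MonoidAlgebra.coeff_mapRingHom]
    rw [← map_sum, hV, map_mul, map_pow, map_natCast]
    rfl
  rw [hV'] at hD
  have hsc : (-1 : ZMod (p ^ (k + 1))) ^ (cycLevel p 0 r).primeFactors.card *
        kuriharaNumber f (p ^ (k + 1)) (cycLevel p 0 r) ψ *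
        (((p : ℕ) : ZMod (p ^ (k + 1))) ^ α * (wK : ZMod (p ^ (k + 1)))) =
      (-1 : ZMod (p ^ (k + 1))) ^ (cycLevel p 0 r).primeFactors.card *
        (((p : ℕ) : ZMod (p ^ (k + 1))) ^ α * kuriharaNumber f (p ^ (k + 1)) (cycLevel p 0 r) ψ) *
        (wK : ZMod (p ^ (k + 1))) := by ring
  rw [hsc] at hD
  -- ### the scalar `λ = n(r)` is a `p`-adic unit (T-PK6-VAL FILE 2)
  obtain ⟨u, hu⟩ := TameLevel.exists_units_coe_eq_cycLevel_zero p r hrp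
  rw [← Rat.cast_natCast] at hu
  -- ### the comparison: membership ⟹ E-C's `hXY`; then T-PK6-VAL FILE 1 ★ (hval + unit reading)
  obtain ⟨Wc, hXY⟩ := GroupRingEval.exists_comparison_of_mem_map_span p (cycLevel p 0 r) r
    (fun q => modNCyclotomicCharacter ℚ (cycLevel p 0 r) (σ q))
    (fun q => ((primesEquiv q : Nat.Primes) : ℕ) - 1) _ (Θ₀ * V) (k + 1) hmem
  obtain ⟨s, hval, w, hw⟩ := GroupRingEval.exists_witness_hval_and_toZModPow_eq p (cycLevel p 0 r) hsf
    r (fun q => modNCyclotomicCharacter ℚ (cycLevel p 0 r) (σ q))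
    (fun q => ((primesEquiv q : Nat.Primes) : ℕ) - 1) xr X hxX _ u hu (Θ₀ * V) Wc k t
    (((p : ℕ) : ZMod (p ^ (k + 1))) ^ α * kuriharaNumber f (p ^ (k + 1)) (cycLevel p 0 r) ψ) wK hXY hD hnorm
    (ZetaValue.pairwise_commute_fieldDeriv (cycLevel p 0 r)
      (fun ℓ => modNCyclotomicCharacter ℚ (cycLevel p 0 r) (σ ℓ))
      (fun ℓ => ((primesEquiv ℓ : Nat.Primes) : ℕ) - 1) r)
  -- ### packaging in PK-6₂'s currency (`ψ` onto at `N𝔮`; `kuriharaNumber` at `∏ N𝔮`)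
  refine ⟨s, w, ψ, fun q hq => (hψ _ q hq rfl).1, hval, ?_⟩
  haveI : NeZero (∏ q ∈ r, Ideal.absNorm q.asIdeal) :=
    ⟨Finset.prod_ne_zero_iff.2 fun q _ h => q.ne_bot (Ideal.absNorm_eq_zero_iff.1 h)⟩
  rw [hw, ← kuriharaNumber_congr f (p ^ (k + 1)) (cycLevel_zero_eq_prod_absNorm p r) ψ]

end Row

end Summit.BirchSwinnertonDyer.BirchSwinnertonDyer.Theorems.KimAtThreeDeepUpperValueRowPow

end
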